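import Literature.NumberTheory.DiophantineApproximation.VandermondeDiscrepancy
import Mathlib.Analysis.SpecialFunctions.Pow.Real
import Mathlib.Analysis.SpecialFunctions.Log.Basic
import Mathlib.Tactic
import HarnessLib

/-!
# The holomorphic dampener `W(𝐳) = Π_k V(𝐳^{(k)})^M` on the torus (CDT §6.5.2–6.5.3)

Calegari–Dimitrov–Tang, arXiv:2408.15403, §6.5.2 eq. (6.18) and §6.5.3 eqs. (6.19)–(6.20)
(p. 52): for a partition of the variables `𝐳 = (𝐳^{(0)},…,𝐳^{(l)})` into blocks and the
dampener `W(𝐳) = Π_{k=0}^{l} V(𝐳^{(k)})^M` (`V` the Vandermonde product),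
Fekete's bound (Lemma 63) gives the uniform bound **(6.20)**
`sup_{𝕋^d} |W| ≤ Π_k d_k^{M d_k/2} ≤ d^{Md/2}`, and Bilu's non-equidistribution lemma
(Lemma 64) gives **(6.19)**: if some block has box discrepancy `D(𝐳^{(k)}) ≥ ε` then
`|W(𝐳)| < e^{−c'(ε) M d²}`, uniformly in `d` once the blocks have length `≥ λ d` and
`d ≫_{ε,λ} 1` (here with the explicit `c'(ε) = (π²ε³/192)·λ²/2`).

Blocks are given abstractly by their lengths `dl : Fin (l+1) → ℕ` and the points of each block
`t k : Fin (dl k) → [0,1)` (`𝐳^{(k)} = e(𝐭^{(k)})`); `dampener M t = Π_k |V(e(𝐭^{(k)}))|^M`.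

* `Discrepancy.dampener_le_prod_rpow`, `Discrepancy.dampener_le_rpow` — eq. (6.20);
* `Discrepancy.dampener_lt_exp_of_le_boxDiscrepancy` — eq. (6.19) for one bad block of length
  `N ≥ d₀(ε)`: `W < e^{−c(ε) M N²} · d^{M(d−N)/2}`;
* `Discrepancy.dampener_le_exp_neg` — the uniform form of (6.19) for blocks of length `≥ λd`,
  `d` large.

No named facts.

## References

* [CalegariDimitrovTang2024] arXiv:2408.15403, §6.5.1 Lemmas 63–64, §6.5.2 eq. (6.18), §6.5.3
  eqs. (6.19)–(6.20) (p. 52).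
-/

noncomputable section

open Finset Real

namespace Literature.NumberTheory.DiophantineApproximation

namespace Discrepancy

variable {l : ℕ} {dl : Fin (l + 1) → ℕ}

/-- The dampener `|W(𝐳)| = Π_k |V(𝐳^{(k)})|^M` on the torus, in block form `𝐳^{(k)} = e(𝐭^{(k)})`.
[cite: CalegariDimitrovTang2024, §6.5.2 eq. (6.18)] -/
def dampener (M : ℕ) (t : (k : Fin (l + 1)) → Fin (dl k) → ℝ) : ℝ :=
  ∏ k, vandermondeAbs (fun n => unitPt (t k n)) ^ M

/-- `|W| ≥ 0`. [folklore] -/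
theorem dampener_nonneg (M : ℕ) (t : (k : Fin (l + 1)) → Fin (dl k) → ℝ) :
    0 ≤ dampener M t :=
  Finset.prod_nonneg fun _ _ => pow_nonneg (vandermondeAbs_nonneg _) M

/-- **Eq. (6.20), first inequality**: `|W| ≤ Π_k d_k^{M d_k/2}` (Fekete, Lemma 63, blockwise).
[cite: CalegariDimitrovTang2024, §6.5.3 eq. (6.20)] -/
theorem dampener_le_prod_rpow (M : ℕ) (t : (k : Fin (l + 1)) → Fin (dl k) → ℝ) :
    dampener M t ≤ ∏ k, ((dl k : ℝ) ^ ((dl k : ℝ) / 2)) ^ M := by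
  unfold dampener
  refine Finset.prod_le_prod (fun k _ => pow_nonneg (vandermondeAbs_nonneg _) M) fun k _ => ?_
  exact pow_le_pow_left₀ (vandermondeAbs_nonneg _)
    (vandermondeAbs_le_rpow _ fun i => (norm_unitPt _).le) M

/-- **Eq. (6.20)**: `|W| ≤ d^{Md/2}` where `d = Σ_k d_k`. [cite: CalegariDimitrovTang2024, §6.5.3
eq. (6.20)] -/
theorem dampener_le_rpow (M : ℕ) (t : (k : Fin (l + 1)) → Fin (dl k) → ℝ) {d : ℕ}
    (hd : ∑ k, dl k = d) :
    dampener M t ≤ (d : ℝ) ^ ((M : ℝ) * d / 2) := by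
  have hdk : ∀ k, dl k ≤ d := fun k => by
    rw [← hd]; exact Finset.single_le_sum (fun _ _ => Nat.zero_le _) (Finset.mem_univ k)
  refine (dampener_le_prod_rpow M t).trans ?_
  -- `Π_k (d_k^{d_k/2})^M ≤ Π_k (d^{d_k/2})^M = d^{M d/2}`
  have h1 : ∏ k, ((dl k : ℝ) ^ ((dl k : ℝ) / 2)) ^ M ≤ ∏ k, ((d : ℝ) ^ ((dl k : ℝ) / 2)) ^ M := by
    refine Finset.prod_le_prod (fun k _ => by positivity) fun k _ => ?_
    refine pow_le_pow_left₀ (by positivity) ?_ M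
    exact Real.rpow_le_rpow (Nat.cast_nonneg _) (by exact_mod_cast hdk k) (by positivity)
  refine h1.trans (le_of_eq ?_)
  rcases Nat.eq_zero_or_pos d with hd0 | hdpos
  · -- `d = 0`: all blocks empty
    subst hd0
    have hall : ∀ k, dl k = 0 := fun k => Nat.le_zero.mp (hdk k)
    simp [hall]
  have hdr : (0 : ℝ) < d := by exact_mod_cast hdpos
  have hpt : ∀ k ∈ (Finset.univ : Finset (Fin (l + 1))),
      ((d : ℝ) ^ ((dl k : ℝ) / 2)) ^ M = (d : ℝ) ^ ((M : ℝ) * dl k / 2) := fun k _ => by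
    rw [← Real.rpow_natCast, ← Real.rpow_mul hdr.le]; congr 1; ring
  rw [Finset.prod_congr rfl hpt, ← Real.rpow_sum_of_pos hdr]
  congr 1
  rw [← Finset.sum_div, ← Finset.mul_sum, ← Nat.cast_sum, hd]

/-- **Eq. (6.19), one bad block**: if block `k₀` (of length `≥ d₀(ε)`, Bilu's threshold) has
`D(𝐭^{(k₀)}) ≥ ε`, then `|W| < e^{−c(ε) M d_{k₀}²} · Π_{k ≠ k₀} d_k^{M d_k/2}` with
`c(ε) = π²ε³/192` (`M ≥ 1`). [cite: CalegariDimitrovTang2024, §6.5.3 eq. (6.19) (proof: Lemma 64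
on the bad block, Lemma 63 on the others)] -/
theorem dampener_lt_exp_of_le_boxDiscrepancy {M : ℕ} (hM : 0 < M)
    (t : (k : Fin (l + 1)) → Fin (dl k) → ℝ) (ht0 : ∀ k n, 0 ≤ t k n) (ht1 : ∀ k n, t k n < 1)
    {ε : ℝ} (hε : 0 < ε) (k₀ : Fin (l + 1)) (hN : biluThreshold ε ≤ dl k₀)
    (hD : ε ≤ boxDiscrepancy (t k₀)) :
    dampener M t < Real.exp (-(π ^ 2 * ε ^ 3 / 192) * (dl k₀ : ℝ) ^ 2) ^ M *
      ∏ k ∈ Finset.univ.erase k₀, ((dl k : ℝ) ^ ((dl k : ℝ) / 2)) ^ M := by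
  unfold dampener
  rw [← Finset.mul_prod_erase _ _ (Finset.mem_univ k₀)]
  have hbad := vandermondeAbs_lt_exp_of_le_boxDiscrepancy hε hN (t k₀) (ht0 k₀) (ht1 k₀) hD
  have hbadM : vandermondeAbs (fun n => unitPt (t k₀ n)) ^ M <
      Real.exp (-(π ^ 2 * ε ^ 3 / 192) * (dl k₀ : ℝ) ^ 2) ^ M :=
    pow_lt_pow_left₀ hbad (vandermondeAbs_nonneg _) hM.ne'
  have hrest : ∏ k ∈ Finset.univ.erase k₀, vandermondeAbs (fun n => unitPt (t k n)) ^ M ≤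
      ∏ k ∈ Finset.univ.erase k₀, ((dl k : ℝ) ^ ((dl k : ℝ) / 2)) ^ M :=
    Finset.prod_le_prod (fun k _ => pow_nonneg (vandermondeAbs_nonneg _) M) fun k _ =>
      pow_le_pow_left₀ (vandermondeAbs_nonneg _) (vandermondeAbs_le_rpow _ fun i => (norm_unitPt _).le) M
  have hrest0 : 0 ≤ ∏ k ∈ Finset.univ.erase k₀, vandermondeAbs (fun n => unitPt (t k n)) ^ M :=
    Finset.prod_nonneg fun k _ => pow_nonneg (vandermondeAbs_nonneg _) M
  have hfac : ∀ k : Fin (l + 1), 0 < ((dl k : ℝ) ^ ((dl k : ℝ) / 2)) ^ M := by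
    intro k
    apply pow_pos
    rcases Nat.eq_zero_or_pos (dl k) with h | h
    · simp [h]
    · exact Real.rpow_pos_of_pos (by exact_mod_cast h) _
  have hR : 0 < Real.exp (-(π ^ 2 * ε ^ 3 / 192) * (dl k₀ : ℝ) ^ 2) ^ M *
      ∏ k ∈ Finset.univ.erase k₀, ((dl k : ℝ) ^ ((dl k : ℝ) / 2)) ^ M :=
    mul_pos (pow_pos (Real.exp_pos _) M) (Finset.prod_pos fun k _ => hfac k)
  rcases eq_or_lt_of_le hrest0 with h0 | hpos
  · rw [← h0, mul_zero]; exact hR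
  · calc vandermondeAbs (fun n => unitPt (t k₀ n)) ^ M *
          ∏ k ∈ Finset.univ.erase k₀, vandermondeAbs (fun n => unitPt (t k n)) ^ M
        < Real.exp (-(π ^ 2 * ε ^ 3 / 192) * (dl k₀ : ℝ) ^ 2) ^ M *
          ∏ k ∈ Finset.univ.erase k₀, vandermondeAbs (fun n => unitPt (t k n)) ^ M :=
          mul_lt_mul_of_pos_right hbadM hpos
      _ ≤ _ := mul_le_mul_of_nonneg_left hrest (pow_nonneg (Real.exp_nonneg _) M)

/-- **Eq. (6.19), uniform form**: if every block has length `≥ λd` (`0 < λ ≤ 1`), then for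
`d` large (depending on `ε, λ`), whenever some block has `D ≥ ε`,
`|W| ≤ e^{−c'(ε,λ) M d²}` with `c'(ε,λ) = (π²ε³/192)·λ²/2`. Proof: the bad block gives
`e^{−c M d_{k₀}²} ≤ e^{−c λ² M d²}`, the others at most `d^{Md/2} = e^{(Md log d)/2}`, and
`(d log d)/2 ≤ c λ² d²/2` for `d ≫ 1`. [cite: CalegariDimitrovTang2024, §6.5.3 eq. (6.19)] -/
theorem dampener_le_exp_neg {ε lam : ℝ} (hε : 0 < ε) (hlam : 0 < lam) :
    ∃ d₁ : ℕ, ∀ (d : ℕ), d₁ ≤ d → ∀ (M : ℕ), 0 < M →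
      ∀ (t : (k : Fin (l + 1)) → Fin (dl k) → ℝ), (∀ k n, 0 ≤ t k n) → (∀ k n, t k n < 1) →
      ∑ k, dl k = d → (∀ k, lam * d ≤ dl k) →
      ∀ k₀, ε ≤ boxDiscrepancy (t k₀) →
        dampener M t ≤ Real.exp (-((π ^ 2 * ε ^ 3 / 192) * lam ^ 2 / 2) * M * (d : ℝ) ^ 2) := by
  set c : ℝ := π ^ 2 * ε ^ 3 / 192 with hc
  have hc0 : 0 < c := by positivity
  -- `d₁`: Bilu threshold on blocks and `log d ≤ c λ² d`
  have hev : ∀ᶠ d : ℕ in Filter.atTop, Real.log d ≤ c * lam ^ 2 * d ∧ biluThreshold ε ≤ lam * d := by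
    have h1 : Filter.Tendsto (fun d : ℕ => Real.log d / d) Filter.atTop (nhds 0) := by
      have h := Real.tendsto_pow_log_div_mul_add_atTop 1 0 1 one_ne_zero
      simp only [pow_one, one_mul, add_zero] at h
      exact h.comp tendsto_natCast_atTop_atTop
    have h2 : ∀ᶠ d : ℕ in Filter.atTop, Real.log d / d < c * lam ^ 2 :=
      h1.eventually (gt_mem_nhds (by positivity))
    have h3 : ∀ᶠ d : ℕ in Filter.atTop, biluThreshold ε ≤ lam * d := by
      have : Filter.Tendsto (fun d : ℕ => lam * (d : ℝ)) Filter.atTop Filter.atTop :=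
        Filter.Tendsto.const_mul_atTop hlam tendsto_natCast_atTop_atTop
      exact this.eventually_ge_atTop _
    have h4 : ∀ᶠ d : ℕ in Filter.atTop, 1 ≤ d := Filter.eventually_ge_atTop 1
    filter_upwards [h2, h3, h4] with d hd2 hd3 hd4
    refine ⟨?_, hd3⟩
    have hdr : (0 : ℝ) < d := by exact_mod_cast hd4
    rw [div_lt_iff₀ hdr] at hd2
    linarith
  rw [Filter.eventually_atTop] at hev
  obtain ⟨d₁, hd₁⟩ := hev
  refine ⟨max d₁ 1, fun d hd M hM t ht0 ht1 hsum hblk k₀ hD => ?_⟩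
  obtain ⟨hlog, hthr⟩ := hd₁ d (le_of_max_le_left hd)
  have hd1 : 1 ≤ d := le_of_max_le_right hd
  have hdr : (0 : ℝ) < d := by exact_mod_cast hd1
  have hMr : (0 : ℝ) < M := by exact_mod_cast hM
  have hN : biluThreshold ε ≤ dl k₀ := hthr.trans (hblk k₀)
  have hlt := dampener_lt_exp_of_le_boxDiscrepancy hM t ht0 ht1 hε k₀ hN hD
  -- the remaining factors: `Π_{k ≠ k₀} (d_k^{d_k/2})^M ≤ d^{M d/2}` (Fekete, eq. (6.20))
  have hdk : ∀ k, dl k ≤ d := fun k => by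
    rw [← hsum]; exact Finset.single_le_sum (fun _ _ => Nat.zero_le _) (Finset.mem_univ k)
  have hd1r : (1 : ℝ) ≤ d := by exact_mod_cast hd1
  have hprod : ∏ k ∈ Finset.univ.erase k₀, ((dl k : ℝ) ^ ((dl k : ℝ) / 2)) ^ M ≤
      (d : ℝ) ^ ((M : ℝ) * d / 2) := by
    have h1 : ∏ k ∈ Finset.univ.erase k₀, ((dl k : ℝ) ^ ((dl k : ℝ) / 2)) ^ M ≤
        ∏ k ∈ Finset.univ.erase k₀, (d : ℝ) ^ ((M : ℝ) * dl k / 2) := by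
      refine Finset.prod_le_prod (fun k _ => by positivity) fun k _ => ?_
      calc ((dl k : ℝ) ^ ((dl k : ℝ) / 2)) ^ M ≤ ((d : ℝ) ^ ((dl k : ℝ) / 2)) ^ M :=
            pow_le_pow_left₀ (by positivity)
              (Real.rpow_le_rpow (Nat.cast_nonneg _) (by exact_mod_cast hdk k) (by positivity)) M
        _ = (d : ℝ) ^ ((M : ℝ) * dl k / 2) := by
            rw [← Real.rpow_natCast, ← Real.rpow_mul hdr.le]; congr 1; ring
    refine h1.trans ?_
    rw [← Real.rpow_sum_of_pos hdr]
    apply Real.rpow_le_rpow_of_exponent_le hd1r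
    have hs : ∑ k ∈ Finset.univ.erase k₀, ((M : ℝ) * dl k / 2) =
        (M : ℝ) / 2 * ∑ k ∈ Finset.univ.erase k₀, (dl k : ℝ) := by
      rw [Finset.mul_sum]; exact Finset.sum_congr rfl fun k _ => by ring
    have hle : ∑ k ∈ Finset.univ.erase k₀, (dl k : ℝ) ≤ d := by
      have : ∑ k ∈ Finset.univ.erase k₀, dl k ≤ ∑ k, dl k :=
        Finset.sum_le_sum_of_subset (Finset.erase_subset _ _)
      rw [hsum] at this; exact_mod_cast this
    rw [hs]
    have hM0 : (0 : ℝ) ≤ (M : ℝ) / 2 := by positivity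
    nlinarith [mul_le_mul_of_nonneg_left hle hM0]
  rw [← hc] at hlt
  have hW : dampener M t ≤ Real.exp (-c * (dl k₀ : ℝ) ^ 2) ^ M * (d : ℝ) ^ ((M : ℝ) * d / 2) :=
    (hlt.trans_le (mul_le_mul_of_nonneg_left hprod (pow_nonneg (Real.exp_nonneg _) M))).le
  refine hW.trans ?_
  rw [← Real.exp_nat_mul, Real.rpow_def_of_pos hdr, ← Real.exp_add, Real.exp_le_exp]
  -- `−cMN² + (Md/2) log d ≤ −(cλ²/2) M d²`
  have hNr : lam * d ≤ (dl k₀ : ℝ) := hblk k₀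
  have hN2 : (lam * d) ^ 2 ≤ (dl k₀ : ℝ) ^ 2 := pow_le_pow_left₀ (by positivity) hNr 2
  have p1 := mul_le_mul_of_nonneg_left hN2 (show (0 : ℝ) ≤ c * M by positivity)
  have p2 := mul_le_mul_of_nonneg_right hlog (show (0 : ℝ) ≤ (M : ℝ) * d / 2 by positivity)
  nlinarith [p1, p2]



/-- **Eq. (6.19), uniform form with the block sizes quantified inside** (the threshold `d₁`
depends only on `ε, λ`, not on the block sizes `d_k`): for `d ≥ d₁(ε,λ)`, any blocks with
`Σ_k d_k = d`, `d_k ≥ λd`, any `M ≥ 1` and any torus point one of whose blocks has `D ≥ ε`,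
`|W| ≤ e^{−c'(ε,λ) M d²}`, `c'(ε,λ) = (π²ε³/192)·λ²/2`.
[cite: CalegariDimitrovTang2024, §6.5.3 eq. (6.19) (p. 52)] -/
theorem dampener_le_exp_neg_uniform {ε lam : ℝ} (hε : 0 < ε) (hlam : 0 < lam) :
    ∃ d₁ : ℕ, ∀ (d : ℕ), d₁ ≤ d → ∀ (dl' : Fin (l + 1) → ℕ) (M : ℕ), 0 < M →
      ∀ (t : (k : Fin (l + 1)) → Fin (dl' k) → ℝ), (∀ k n, 0 ≤ t k n) → (∀ k n, t k n < 1) →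
      ∑ k, dl' k = d → (∀ k, lam * d ≤ dl' k) →
      ∀ k₀, ε ≤ boxDiscrepancy (t k₀) →
        dampener M t ≤ Real.exp (-((π ^ 2 * ε ^ 3 / 192) * lam ^ 2 / 2) * M * (d : ℝ) ^ 2) := by
  set c : ℝ := π ^ 2 * ε ^ 3 / 192 with hc
  have hc0 : 0 < c := by positivity
  -- `d₁`: Bilu threshold on blocks and `log d ≤ c λ² d`
  have hev : ∀ᶠ d : ℕ in Filter.atTop, Real.log d ≤ c * lam ^ 2 * d ∧ biluThreshold ε ≤ lam * d := by
    have h1 : Filter.Tendsto (fun d : ℕ => Real.log d / d) Filter.atTop (nhds 0) := by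
      have h := Real.tendsto_pow_log_div_mul_add_atTop 1 0 1 one_ne_zero
      simp only [pow_one, one_mul, add_zero] at h
      exact h.comp tendsto_natCast_atTop_atTop
    have h2 : ∀ᶠ d : ℕ in Filter.atTop, Real.log d / d < c * lam ^ 2 :=
      h1.eventually (gt_mem_nhds (by positivity))
    have h3 : ∀ᶠ d : ℕ in Filter.atTop, biluThreshold ε ≤ lam * d := by
      have : Filter.Tendsto (fun d : ℕ => lam * (d : ℝ)) Filter.atTop Filter.atTop :=
        Filter.Tendsto.const_mul_atTop hlam tendsto_natCast_atTop_atTop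
      exact this.eventually_ge_atTop _
    have h4 : ∀ᶠ d : ℕ in Filter.atTop, 1 ≤ d := Filter.eventually_ge_atTop 1
    filter_upwards [h2, h3, h4] with d hd2 hd3 hd4
    refine ⟨?_, hd3⟩
    have hdr : (0 : ℝ) < d := by exact_mod_cast hd4
    rw [div_lt_iff₀ hdr] at hd2
    linarith
  rw [Filter.eventually_atTop] at hev
  obtain ⟨d₁, hd₁⟩ := hev
  refine ⟨max d₁ 1, fun d hd dl' M hM t ht0 ht1 hsum hblk k₀ hD => ?_⟩
  obtain ⟨hlog, hthr⟩ := hd₁ d (le_of_max_le_left hd)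
  have hd1 : 1 ≤ d := le_of_max_le_right hd
  have hdr : (0 : ℝ) < d := by exact_mod_cast hd1
  have hMr : (0 : ℝ) < M := by exact_mod_cast hM
  have hN : biluThreshold ε ≤ dl' k₀ := hthr.trans (hblk k₀)
  have hlt := dampener_lt_exp_of_le_boxDiscrepancy hM t ht0 ht1 hε k₀ hN hD
  -- the remaining factors: `Π_{k ≠ k₀} (d_k^{d_k/2})^M ≤ d^{M d/2}` (Fekete, eq. (6.20))
  have hdk : ∀ k, dl' k ≤ d := fun k => by
    rw [← hsum]; exact Finset.single_le_sum (fun _ _ => Nat.zero_le _) (Finset.mem_univ k)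
  have hd1r : (1 : ℝ) ≤ d := by exact_mod_cast hd1
  have hprod : ∏ k ∈ Finset.univ.erase k₀, ((dl' k : ℝ) ^ ((dl' k : ℝ) / 2)) ^ M ≤
      (d : ℝ) ^ ((M : ℝ) * d / 2) := by
    have h1 : ∏ k ∈ Finset.univ.erase k₀, ((dl' k : ℝ) ^ ((dl' k : ℝ) / 2)) ^ M ≤
        ∏ k ∈ Finset.univ.erase k₀, (d : ℝ) ^ ((M : ℝ) * dl' k / 2) := by
      refine Finset.prod_le_prod (fun k _ => by positivity) fun k _ => ?_
      calc ((dl' k : ℝ) ^ ((dl' k : ℝ) / 2)) ^ M ≤ ((d : ℝ) ^ ((dl' k : ℝ) / 2)) ^ M :=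
            pow_le_pow_left₀ (by positivity)
              (Real.rpow_le_rpow (Nat.cast_nonneg _) (by exact_mod_cast hdk k) (by positivity)) M
        _ = (d : ℝ) ^ ((M : ℝ) * dl' k / 2) := by
            rw [← Real.rpow_natCast, ← Real.rpow_mul hdr.le]; congr 1; ring
    refine h1.trans ?_
    rw [← Real.rpow_sum_of_pos hdr]
    apply Real.rpow_le_rpow_of_exponent_le hd1r
    have hs : ∑ k ∈ Finset.univ.erase k₀, ((M : ℝ) * dl' k / 2) =
        (M : ℝ) / 2 * ∑ k ∈ Finset.univ.erase k₀, (dl' k : ℝ) := by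
      rw [Finset.mul_sum]; exact Finset.sum_congr rfl fun k _ => by ring
    have hle : ∑ k ∈ Finset.univ.erase k₀, (dl' k : ℝ) ≤ d := by
      have : ∑ k ∈ Finset.univ.erase k₀, dl' k ≤ ∑ k, dl' k :=
        Finset.sum_le_sum_of_subset (Finset.erase_subset _ _)
      rw [hsum] at this; exact_mod_cast this
    rw [hs]
    have hM0 : (0 : ℝ) ≤ (M : ℝ) / 2 := by positivity
    nlinarith [mul_le_mul_of_nonneg_left hle hM0]
  rw [← hc] at hlt
  have hW : dampener M t ≤ Real.exp (-c * (dl' k₀ : ℝ) ^ 2) ^ M * (d : ℝ) ^ ((M : ℝ) * d / 2) :=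
    (hlt.trans_le (mul_le_mul_of_nonneg_left hprod (pow_nonneg (Real.exp_nonneg _) M))).le
  refine hW.trans ?_
  rw [← Real.exp_nat_mul, Real.rpow_def_of_pos hdr, ← Real.exp_add, Real.exp_le_exp]
  -- `−cMN² + (Md/2) log d ≤ −(cλ²/2) M d²`
  have hNr : lam * d ≤ (dl' k₀ : ℝ) := hblk k₀
  have hN2 : (lam * d) ^ 2 ≤ (dl' k₀ : ℝ) ^ 2 := pow_le_pow_left₀ (by positivity) hNr 2
  have p1 := mul_le_mul_of_nonneg_left hN2 (show (0 : ℝ) ≤ c * M by positivity)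
  have p2 := mul_le_mul_of_nonneg_right hlog (show (0 : ℝ) ≤ (M : ℝ) * d / 2 by positivity)
  nlinarith [p1, p2]

end Discrepancy

end Literature.NumberTheory.DiophantineApproximation
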